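import Literature.Topology.FourManifolds.SeifertSurfaceOrientation
import Literature.Topology.FourManifolds.RegularLevelCollar
import HarnessLib

/-!
# The closed-up level surface of a knot complement as a regular level on the whole sphere

Topic `Literature/Topology/FourManifolds`; first step of the bicollar of a Seifert surface
(towards the Seifert presentation of the Alexander module, `KnotAlexanderPresentation.lean`, and
the Fox–Milnor theorem, `SliceKnotsFoxMilnorPairing.lean`). For a Seifert datum `D` of the knot
`K` (`SeifertLevelSurface.lean`: tube `ν`, circle map `θ`, regular value `v` with regular
antipode) the closed-up level surface `Λ = K ∪ θ⁻¹{v, -v} ⊆ 𝕊³` (`D.sheet`) is the zero set of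
the level function `H` of `SeifertSurfaceOrientation.lean` (`SeifertDatum.levelFn`: the modified
tube function `G̃ = ⟪w, Jv⟫ k(‖w‖²)` on the unit tube, the sheet function `F = χ ⟪θ, Jv⟫`
elsewhere, the two agreeing on the overlap), which is defined on the open neighbourhood
`D.nbhd` of `Λ` only. Since off the tube of radius `1/2` both branches make sense on the whole
sphere, the same recipe defines a smooth function on ALL of `𝕊³`:

* `SeifertDatum.sphereLevelFn` — `G̃` on the unit tube, `F` off it; it restricts to `levelFn` on
  `D.nbhd` (`levelFn_eq_sphereLevelFn`, by `rfl`), is smooth on `𝕊³` (`contMDiff_sphereLevelFn`),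
  reads `⟪w, Jv⟫ k(‖w‖²)` in the unit tube (`sphereLevelFn_apply`, `k > 0`) and `⟪θ, Jv⟫` off the
  tube of radius `1/2` (`sphereLevelFn_eq_inner`);
* `sphereLevelFn_eq_zero_iff` — **its zero set is exactly `Λ`**, and
  `not_isMCriticalPt_sphereLevelFn` — **`0` is a regular value**;
* `isRegularLevel_sphereLevelFn`, `nonempty_levelUnitField` — so `Λ` is a regular level of a
  smooth function on the *closed* `3`-manifold `𝕊³`, and the tree's product-neighbourhood theorem
  (`RegularLevelCollar.lean`; Milnor 1963, Thm. 3.1) provides a unit-speed field across `Λ` whose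
  global flow sweeps out a bicollar `Λ × (-δ, δ)` of `Λ` in `𝕊³` (Rolfsen 1976, §5.A: Seifert
  surfaces are bicollared).

Everything is proved; no named fact is introduced.

## References

* J. Milnor, *Morse theory*, Ann. of Math. Studies 51 (1963), Thm. 3.1 (product neighbourhood
  of a regular level). [Milnor1963]
* A. Juhász, *Differential and Low-Dimensional Topology* (2023), proof of Prop. 4.10.
  [Juhasz2023]
* D. Rolfsen, *Knots and Links*, Publish or Perish (1976), §5.A (bicollars). [Rolfsen1976]
-/

open scoped Manifold ContDiff Topology RealInnerProductSpace
open Function Set Filter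

noncomputable section

namespace Literature.Topology.FourManifolds

/-- Local notation: `𝔼 n` is the model Euclidean space `EuclideanSpace ℝ (Fin n)`. -/
local notation "𝔼 " n:arg => EuclideanSpace ℝ (Fin n)

/-- Local notation: `𝕊 n` is the unit sphere in `EuclideanSpace ℝ (Fin (n + 1))`. -/
local notation "𝕊 " n:arg => (Metric.sphere (0 : EuclideanSpace ℝ (Fin (n + 1))) 1)

namespace SeifertDatum

open scoped Classical

variable {K : Knot} (D : SeifertDatum K)

/-! ### The level function on the whole sphere -/

/-- **The level function of `Λ` on `𝕊³`**: `G̃` on the unit tube, `F` off it. [folklore] -/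
def sphereLevelFn (p : 𝕊 3) : ℝ := if p ∈ D.tubeSet 1 then D.tubeFn' p else D.sheetFn p

/-- On `D.nbhd` it is the level function `H` of `SeifertSurfaceOrientation.lean`. [folklore] -/
theorem levelFn_eq_sphereLevelFn (q : D.nbhd) : D.levelFn q = D.sphereLevelFn q.1 := rfl

/-- On the unit tube it is `G̃`. [folklore] -/
theorem sphereLevelFn_of_mem_tubeSet {p : 𝕊 3} (h : p ∈ D.tubeSet 1) :
    D.sphereLevelFn p = D.tubeFn' p := if_pos h

/-- **In the unit tube**: `sphereLevelFn (ν (x, w)) = ⟪w, Jv⟫ k(‖w‖²)` for `‖w‖ < 1`. [folklore] -/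
theorem sphereLevelFn_apply (x : 𝕊 1) {w : 𝔼 2} (hw : ‖w‖ < 1) :
    D.sphereLevelFn (D.ν (x, w)) = ⟪w, quarterRot (D.v : 𝔼 2)⟫ * invSqrtBlend (‖w‖ ^ 2) := by
  rw [D.sphereLevelFn_of_mem_tubeSet (D.apply_mem_tubeSet_iff.2 hw),
    D.tubeFn'_apply_of_norm_le_one x hw.le]

/-- The closed tube of radius `1/2` lies in the open unit tube. [folklore] -/
theorem closedTubeSet_half_subset_tubeSet_one : D.closedTubeSet (1 / 2) ⊆ D.tubeSet 1 := by
  rintro _ ⟨⟨x, w⟩, ⟨-, hw⟩, rfl⟩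
  rw [apply_mem_tubeSet_iff]
  have : ‖w‖ ≤ 1 / 2 := by simpa using hw
  linarith

/-- **Off the closed tube of radius `1/2` it is the sheet function** (on the overlap with the
unit tube `G̃ = F`, `tubeFn'_eq_sheetFn`). [folklore] -/
theorem sphereLevelFn_eq_sheetFn {p : 𝕊 3} (hp : p ∉ D.closedTubeSet (1 / 2)) :
    D.sphereLevelFn p = D.sheetFn p := by
  by_cases ht : p ∈ D.tubeSet 1
  · rw [D.sphereLevelFn_of_mem_tubeSet ht]
    obtain ⟨⟨x, w⟩, ⟨-, hw⟩, rfl⟩ := ht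
    have hw1 : ‖w‖ < 1 := by simpa using hw
    rw [apply_mem_closedTubeSet_iff, not_le] at hp
    exact D.tubeFn'_eq_sheetFn x hp hw1.le
  · exact if_neg ht

/-- **Off the closed tube of radius `1/2` it is `⟪θ, Jv⟫`.** [folklore] -/
theorem sphereLevelFn_eq_inner {p : 𝕊 3} (hp : p ∉ D.closedTubeSet (1 / 2)) :
    D.sphereLevelFn p = ⟪D.θhat p, quarterRot (D.v : 𝔼 2)⟫ := by
  rw [D.sphereLevelFn_eq_sheetFn hp, D.sheetFn_eq_of_not_mem hp]

/-- Near a point off the unit tube, `sphereLevelFn` agrees with the sheet function. [folklore] -/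
theorem sphereLevelFn_eventuallyEq_sheetFn {p : 𝕊 3} (hp : p ∉ D.closedTubeSet (1 / 2)) :
    D.sphereLevelFn =ᶠ[𝓝 p] D.sheetFn := by
  filter_upwards [(D.isClosed_closedTubeSet (1 / 2)).isOpen_compl.mem_nhds hp] with q hq
  exact D.sphereLevelFn_eq_sheetFn hq

/-- Near a point of the unit tube, `sphereLevelFn` agrees with `G̃`. [folklore] -/
theorem sphereLevelFn_eventuallyEq_tubeFn' {p : 𝕊 3} (hp : p ∈ D.tubeSet 1) :
    D.sphereLevelFn =ᶠ[𝓝 p] D.tubeFn' := by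
  filter_upwards [(D.isOpen_tubeSet 1).mem_nhds hp] with q hq
  exact D.sphereLevelFn_of_mem_tubeSet hq

/-- **`sphereLevelFn` is smooth on `𝕊³`.** [folklore] -/
theorem contMDiff_sphereLevelFn : ContMDiff (𝓡 3) 𝓘(ℝ, ℝ) ∞ D.sphereLevelFn := by
  intro p
  by_cases ht : p ∈ D.tubeSet 1
  · exact (D.contMDiff_tubeFn' p).congr_of_eventuallyEq (D.sphereLevelFn_eventuallyEq_tubeFn' ht)
  · exact (D.contMDiff_sheetFn p).congr_of_eventuallyEq
      (D.sphereLevelFn_eventuallyEq_sheetFn fun h => ht (D.closedTubeSet_half_subset_tubeSet_one h))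

/-- `sphereLevelFn` is continuous. [folklore] -/
theorem continuous_sphereLevelFn : Continuous D.sphereLevelFn := D.contMDiff_sphereLevelFn.continuous

/-! ### Zero set and regularity -/

/-- **The zero set of `sphereLevelFn` is `Λ`.** [folklore] -/
theorem sphereLevelFn_eq_zero_iff (p : 𝕊 3) : D.sphereLevelFn p = 0 ↔ p ∈ D.sheet := by
  by_cases hp : p ∈ D.tubeSet 1
  · rw [D.sphereLevelFn_of_mem_tubeSet hp]
    obtain ⟨⟨x, w⟩, ⟨-, hw⟩, rfl⟩ := hp
    have hw1 : ‖w‖ < 1 := by simpa using hw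
    exact D.tubeFn'_eq_zero_iff x hw1.le
  · have hp' : p ∉ D.closedTubeSet (1 / 2) := fun h => hp (D.closedTubeSet_half_subset_tubeSet_one h)
    have hK : p ∉ range ⇑K := fun h => hp (D.range_K_subset_tubeSet one_pos h)
    rw [D.sphereLevelFn_eq_inner hp', mem_sheet_iff, or_iff_right hK]
    have hu : ‖D.θhat p‖⁻¹ • D.θhat p = D.θhat p := by rw [D.norm_θhat hK, inv_one, one_smul]
    have h0 : D.θhat p ≠ 0 := fun h => by simpa [h] using D.norm_θhat hK
    rw [← norm_inv_smul_eq_or_iff D.norm_v h0, hu]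

/-- As a set, `sphereLevelFn⁻¹{0} = Λ`. [folklore] -/
theorem sphereLevelFn_preimage_zero : D.sphereLevelFn ⁻¹' {0} = D.sheet :=
  Set.ext fun p => D.sphereLevelFn_eq_zero_iff p

/-- `sphereLevelFn` vanishes on the knot. [folklore] -/
theorem sphereLevelFn_eq_zero_of_mem_range {p : 𝕊 3} (hp : p ∈ range ⇑K) : D.sphereLevelFn p = 0 :=
  (D.sphereLevelFn_eq_zero_iff p).2 (D.range_K_subset_sheet hp)

/-- **`0` is a regular value of `sphereLevelFn`**: no point of `Λ` is critical (`G̃` is regular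
along `Λ` in the unit tube, `not_isMCriticalPt_tubeFn'`; `F` is regular on `θ⁻¹{±v}` off the
tube of radius `1/2`, `not_isMCriticalPt_sheetFn`). [folklore] -/
theorem not_isMCriticalPt_sphereLevelFn {p : 𝕊 3} (hs : p ∈ D.sheet) :
    ¬ IsMCriticalPt (𝓡 3) D.sphereLevelFn p := by
  intro hcrit
  by_cases hp : p ∈ D.tubeSet 1
  · have hev := D.sphereLevelFn_eventuallyEq_tubeFn' hp
    obtain ⟨⟨x, w⟩, ⟨-, hw⟩, rfl⟩ := hp
    have hw1 : ‖w‖ < 1 := by simpa using hw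
    apply D.not_isMCriticalPt_tubeFn' x hw1 ((D.apply_mem_sheet_iff x hw1.le).1 hs)
    change mfderiv (𝓡 3) 𝓘(ℝ, ℝ) D.tubeFn' (D.ν (x, w)) = 0
    rw [← hev.mfderiv_eq]
    exact hcrit
  · have hp' : p ∉ D.closedTubeSet (1 / 2) := fun h => hp (D.closedTubeSet_half_subset_tubeSet_one h)
    have hK : p ∉ range ⇑K := fun h => hp' (D.range_K_subset_closedTubeSet h)
    have hθ : D.θhat p = (D.v : 𝔼 2) ∨ D.θhat p = -(D.v : 𝔼 2) := (or_iff_right hK).1 hs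
    apply D.not_isMCriticalPt_sheetFn hK hp' hθ
    change mfderiv (𝓡 3) 𝓘(ℝ, ℝ) D.sheetFn p = 0
    rw [← (D.sphereLevelFn_eventuallyEq_sheetFn hp').mfderiv_eq]
    exact hcrit

/-- **`Λ` is a regular level of the smooth function `sphereLevelFn` on `𝕊³`.** [folklore] -/
theorem isRegularLevel_sphereLevelFn : IsRegularLevel (𝓡 3) D.sphereLevelFn 0 where
  contMDiff := D.contMDiff_sphereLevelFn
  isInteriorPoint _ _ := isInteriorPoint_sphere _
  not_isMCriticalPt _ hp := D.not_isMCriticalPt_sphereLevelFn ((D.sphereLevelFn_eq_zero_iff _).1 hp)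

/-- **A unit-speed field across `Λ`** (Milnor 1963, proof of Thm. 3.1, on the closed manifold
`𝕊³`: `IsRegularLevel.exists_levelUnitField`, `RegularLevelCollar.lean`); its global flow sweeps
out the bicollar of `Λ`. [cite: Milnor1963, proof of Thm. 3.1] -/
theorem nonempty_levelUnitField : Nonempty (LevelUnitField 2 D.sphereLevelFn 0) :=
  D.isRegularLevel_sphereLevelFn.exists_levelUnitField

/-! ### The sign of the level function in the tube -/

/-- **The sign of `sphereLevelFn` in the unit tube is the sign of `⟪w, Jv⟫`** (`k > 0`).
[folklore] -/
theorem sphereLevelFn_apply_pos_iff (x : 𝕊 1) {w : 𝔼 2} (hw : ‖w‖ < 1) :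
    0 < D.sphereLevelFn (D.ν (x, w)) ↔ 0 < ⟪w, quarterRot (D.v : 𝔼 2)⟫ := by
  rw [D.sphereLevelFn_apply x hw]
  exact ⟨fun h => pos_of_mul_pos_left h (invSqrtBlend_pos _).le,
    fun h => mul_pos h (invSqrtBlend_pos _)⟩

/-- Likewise for negativity. [folklore] -/
theorem sphereLevelFn_apply_neg_iff (x : 𝕊 1) {w : 𝔼 2} (hw : ‖w‖ < 1) :
    D.sphereLevelFn (D.ν (x, w)) < 0 ↔ ⟪w, quarterRot (D.v : 𝔼 2)⟫ < 0 := by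
  rw [D.sphereLevelFn_apply x hw]
  exact ⟨fun h => neg_of_mul_neg_left h (invSqrtBlend_pos _).le,
    fun h => mul_neg_of_neg_of_pos h (invSqrtBlend_pos _)⟩

end SeifertDatum

end Literature.Topology.FourManifolds
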